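import Summits.BirchSwinnertonDyer.Rank1Residual.ManinAdditive.QuarterShiftTwistOrbit
import Literature.NumberTheory.EllipticCurves.QuadraticTwistNegOneMinimalDiscriminantProofs
import HarnessLib

/-!
# E-es-166 `NegOneTwistDiscrEqOfAdditive` HOLDS — the `χ₋₄`-orbit reduction of C2 is UNCONDITIONAL
# (cell `bsd-f2-manin`, D-0131 (3) frontier: the Manin constant at additive primes; Euler-system / explicit-reciprocity lens, es g35)

The `@[conjecture]` row **E-es-166 `NegOneTwistDiscrEqOfAdditive`** of `QuarterShiftTwistOrbit.lean` (es g34 §55.8, p-landed by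
T-es-64): «two globally minimal Weierstrass models over `ℚ`, both with `2² ∣ N`, one `ℚ`-isomorphic to the `χ₋₄`-twist of the other,
have the same discriminant» is — up to replacing the explicit isomorphism `u` by `∃ u` — LITERALLY the Literature fact
`Literature.NumberTheory.EllipticCurves.connellPal_Δ_eq_of_negOne_twist_of_four_dvd_conductor` (Pal 2012 Prop. 2.4 (Connell
*Handbook* 5.7.3, corrected), global corollary at `d = −1`, both sides additive at `2`), which is DISCHARGED in the tree by
`connellPal_Δ_eq_of_negOne_twist_of_four_dvd_conductor_holds` (`Literature/NumberTheory/EllipticCurves/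
QuadraticTwistNegOneMinimalDiscriminantProofs.lean`: `u = ±1` from the `a₁, a₃ even ⟹ 16 ∣ c₄, 32 ∣ c₆` case of Kraus's
condition at `2` plus `2`-minimality on both sides, odd places by `valuation_u_eq_one_of_smul_quadraticTwist_of_odd_of_not_dvd`,
then `Δ(W′) = u⁻¹²(−1)⁶Δ(W)`).  an's same-level consumer is `MinusOneOrbitManinEqHolds.lean` (`negOneTwistSameLevelDiscrEq_holds`,
every `M` with `4 ∣ M`); this file is the LEVEL-CHANGING consumer.

CONSEQUENCES, all now hypothesis-free tree theorems (the `_of_discrLaw` glue of `QuarterShiftTwistOrbit.lean` with the law supplied):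
along EVERY `χ₋₄` edge `N ∣ N′ ∣ 4N`, `4² ∣ N′`, between lattice-optimal `X₀`-data `D, D′` on globally minimal curves `W, W′`
additive at `2` (`2² ∣ cond W`, `2² ∣ cond W′`) with `W ⊗ χ₋₄ ~ W′` (isogenous):
* `Δ_eq_of_negOne_twist_of_dvd` : `Δ(W′) = Δ(W)` (optimal rigidity 55.E `negOneOptimalTwistRigidity_of_dvd` gives the `ℚ`-isomorphism, the law the discriminant);
* `maninConstant_natAbs_eq_of_negOne_twist_of_dvd` : **`|c′| = |c|`**; `maninConstant_eq_or_eq_neg_of_negOne_twist_of_dvd` : `c′ = c ∨ c′ = −c`;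
  `padicValInt_maninConstant_eq_of_negOne_twist_of_dvd` : `ord_p c′ = ord_p c` for every `p`;
* `two_dvd_maninConstant_iff_of_negOne_twist_of_dvd` : **`2 ∣ c′ ↔ 2 ∣ c`** — C2 `ManinOddAtFour` (stmt-BirchSwinnertonDyer-22967) is CONSTANT on
  every `χ₋₄`-orbit `{4 ∥ N ↔ 16 ∥ 4N}`, `{8 ∥ N ↔ 16 ∥ 2N}`, `{2⁵ ∣ N, same level}` of lattice-optimal minimal curves: it needs deciding for ONE
  representative per orbit (LEAD offer L-es-g34-1, now with no `hΔ` binder: `maninConstant_natAbs_eq_levelRaising`);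
* `uFamilyOptimalNegOneTwinAtSixteen_of_flat'` : S-es-g34-2♭ ⟹ S-es-g34-2, and `uFamily_maninOdd_sixteen_of_four_of_flat'`.
DATA (es g34 `es/g34/discrlaw_census.py` edc3fa3710f9bb95 → `DISCRLAW-CENSUS-v1.summary` e54338fd9d8e3fb6, all 3 064 705 curves `N ≤ 5·10⁵`):
both-additive `χ₋₄`-pairs `Δ_min′ = Δ_min` 412 130 / 412 130 (227 238 same level, 126 601 ratio 2, 58 291 ratio 4); optimal pairs `|c′| = |c|`
278 549 / 278 549 (`LEVELRAISE-CENSUS-v2`).  HONEST FRAMING: an elementary bookkeeping closure; no new instance of `2 ∤ c_E` is proved here;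
BSD is not proved by this; Manin's conjecture is not proved by this.  No `sorry`; nothing is asserted; axioms = those of the inputs.

TYPER NOTE (typer g21, T-es-65).  SOURCE = HOME/es/g35/QuarterShiftTwistOrbitHolds-es-g35.lean sha16 dd91518b282baf1b (162 l.; es: farm rc
0·0·0·0, std axioms; MEMO-es §56, HOME/es/g35/MEMO-es-sec56.md) VERBATIM except for ONE gate-forced delta: es's headline
`negOneTwistDiscrEqOfAdditive_holds` is already landed (prover p2, `Theorems/ManinLocalTwoThreeNegOneTwistDiscrLaw.lean`, same statement ⇒
`dedup.landed`) but inside the Theses cone, so this cone-free leaf drops the named copy and INLINES es's 3-line derivation from the Literature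
theorem `connellPal_Δ_eq_of_negOne_twist_of_four_dvd_conductor_holds` at the five use sites (see the comment in §«The law holds»).  Everything
else by es's names: `Δ_eq_of_negOne_twist_of_dvd`, `maninConstant_natAbs_eq_of_negOne_twist_of_dvd` (**|c′| = |c| along every χ₋₄ edge
N ∣ N′ ∣ 4N, 4² ∣ N′ — UNCONDITIONAL**), `maninConstant_eq_or_eq_neg_of_negOne_twist_of_dvd`, `padicValInt_maninConstant_eq_of_negOne_twist_of_dvd`,
**`two_dvd_maninConstant_iff_of_negOne_twist_of_dvd`** (C2 constant on χ₋₄-orbits), `maninConstant_natAbs_eq_levelRaising` (LEAD L-es-g34-1 with no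
hΔ binder), `maninConstant_natAbs_eq_sameLevel`, `uFamilyOptimalNegOneTwinAtSixteen_of_flat'`, `uFamilyOptimalNegOneTwinAtSixteenFlat_of`,
`uFamilyOptimalNegOneTwinAtSixteenFlat_iff`, `uFamily_maninOdd_sixteen_of_four_of_flat'`.  Imports: landed `…ManinAdditive.QuarterShiftTwistOrbit`
(p743187) + Literature `QuadraticTwistNegOneMinimalDiscriminantProofs` + HarnessLib — route-independent (p2's cone file carries the same law +
four corollaries under `…Theorems.ManinLocalTwoThree.UFamilyTwin`; both are citable).  Theorem-only (kind proof).  bears_on: stmt-BirchSwinnertonDyer-22967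
(C2 `ManinOddAtFour`).  BSD is not proved by this; C2 OPEN.
-/

noncomputable section

open scoped MatrixGroups ModularForm

open CongruenceSubgroup WeierstrassCurve
  Literature.NumberTheory.DiophantineGeometry
  Literature.NumberTheory.EllipticCurves
  Literature.NumberTheory.EllipticCurves.ModularForms

namespace Summit.BirchSwinnertonDyer.Rank1Residual.ManinAdditive

/-! ## The law holds -/

/- **E-es-166 `NegOneTwistDiscrEqOfAdditive` HOLDS** — TYPER (g21, T-es-65): es's named theorem
`negOneTwistDiscrEqOfAdditive_holds : NegOneTwistDiscrEqOfAdditive` is NOT re-declared here: the gate's `dedup.landed` found the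
identical statement already landed by prover p2 as
`Summit.BirchSwinnertonDyer.BirchSwinnertonDyer.Theorems.ManinLocalTwoThree.UFamilyTwin.negOneTwistDiscrEqOfAdditive_holds`
(`Theorems/ManinLocalTwoThreeNegOneTwistDiscrLaw.lean`), a module INSIDE the `Theses.ManinLocalTwoThree` import cone, which this
route-independent leaf must not import.  The consequences below therefore inline es's three-line derivation from the discharged
Literature fact `connellPal_Δ_eq_of_negOne_twist_of_four_dvd_conductor_holds` (Pal 2012 Prop. 2.4 (Connell), `d = −1`, both sides
additive at `2`; the isomorphism bound by `∃`) at each use site: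
  (by intro W W' _ _ _ _ h4W h4W' hu; obtain ⟨u, hu⟩ := hu;
      exact connellPal_Δ_eq_of_negOne_twist_of_four_dvd_conductor_holds W W' u h4W h4W' hu) -/

/-! ## Along a `χ₋₄` edge `N ∣ N′ ∣ 4N`, `4² ∣ N′`: discriminant, Manin constant, its valuations -/

section Edge

variable {W W' : WeierstrassCurve ℚ} [W.IsElliptic] [W'.IsElliptic] [W.IsGloballyMinimal] [W'.IsGloballyMinimal]
  {N N' : ℕ} [NeZero N] [NeZero N'] (D : ModularParametrizationData W N) (D' : ModularParametrizationData W' N')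

/-- `Δ(W′) = Δ(W)` along every `χ₋₄` edge of lattice-optimal data on globally minimal curves additive at `2`
(optimal rigidity `negOneOptimalTwistRigidity_of_dvd` supplies `u • (W ⊗ (−1)) = W′`; the law supplies the discriminant). -/
theorem Δ_eq_of_negOne_twist_of_dvd (hD : IsLatticeOptimal D) (hD' : IsLatticeOptimal D')
    (hNN' : N ∣ N') (hN'4 : N' ∣ 4 * N) (h16 : 4 ^ 2 ∣ N')
    (h4W : 2 ^ 2 ∣ W.conductorNorm ℤ) (h4W' : 2 ^ 2 ∣ W'.conductorNorm ℤ)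
    (hiso : IsIsogenous (W.quadraticTwist ((-1 : ℤ) : ℚ)) W') : W'.Δ = W.Δ :=
  (show NegOneTwistDiscrEqOfAdditive by
      intro W W' _ _ _ _ h4W h4W' hu; obtain ⟨u, hu⟩ := hu
      exact connellPal_Δ_eq_of_negOne_twist_of_four_dvd_conductor_holds W W' u h4W h4W' hu) W W' h4W h4W'
    (negOneOptimalTwistRigidity_of_dvd D D' hD hD' hNN' hN'4 h16 h4W h4W' hiso)

/-- **`|c′| = |c|` along every `χ₋₄` edge `N ∣ N′ ∣ 4N`, `4² ∣ N′` — UNCONDITIONAL** (THEOREM 55.I with E-es-166 discharged). -/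
theorem maninConstant_natAbs_eq_of_negOne_twist_of_dvd (hD : IsLatticeOptimal D) (hD' : IsLatticeOptimal D')
    (hNN' : N ∣ N') (hN'4 : N' ∣ 4 * N) (h16 : 4 ^ 2 ∣ N')
    (h4W : 2 ^ 2 ∣ W.conductorNorm ℤ) (h4W' : 2 ^ 2 ∣ W'.conductorNorm ℤ)
    (hiso : IsIsogenous (W.quadraticTwist ((-1 : ℤ) : ℚ)) W') : D'.c.natAbs = D.c.natAbs :=
  maninConstant_natAbs_eq_of_dvd_of_discrLaw
    (show NegOneTwistDiscrEqOfAdditive by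
      intro W W' _ _ _ _ h4W h4W' hu; obtain ⟨u, hu⟩ := hu
      exact connellPal_Δ_eq_of_negOne_twist_of_four_dvd_conductor_holds W W' u h4W h4W' hu) D D' hD hD' hNN' hN'4 h16
    h4W h4W' hiso

/-- `c′ = c ∨ c′ = −c` along every such edge. -/
theorem maninConstant_eq_or_eq_neg_of_negOne_twist_of_dvd (hD : IsLatticeOptimal D)
    (hD' : IsLatticeOptimal D') (hNN' : N ∣ N') (hN'4 : N' ∣ 4 * N) (h16 : 4 ^ 2 ∣ N')
    (h4W : 2 ^ 2 ∣ W.conductorNorm ℤ) (h4W' : 2 ^ 2 ∣ W'.conductorNorm ℤ)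
    (hiso : IsIsogenous (W.quadraticTwist ((-1 : ℤ) : ℚ)) W') : D'.c = D.c ∨ D'.c = -D.c :=
  Int.natAbs_eq_natAbs_iff.mp
    (maninConstant_natAbs_eq_of_negOne_twist_of_dvd D D' hD hD' hNN' hN'4 h16 h4W h4W' hiso)

/-- `ord_p c′ = ord_p c` for every `p` along every such edge (the Manin valuation is a `χ₋₄`-orbit invariant). -/
theorem padicValInt_maninConstant_eq_of_negOne_twist_of_dvd (p : ℕ) (hD : IsLatticeOptimal D)
    (hD' : IsLatticeOptimal D') (hNN' : N ∣ N') (hN'4 : N' ∣ 4 * N) (h16 : 4 ^ 2 ∣ N')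
    (h4W : 2 ^ 2 ∣ W.conductorNorm ℤ) (h4W' : 2 ^ 2 ∣ W'.conductorNorm ℤ)
    (hiso : IsIsogenous (W.quadraticTwist ((-1 : ℤ) : ℚ)) W') :
    padicValInt p D'.c = padicValInt p D.c := by
  unfold padicValInt
  rw [maninConstant_natAbs_eq_of_negOne_twist_of_dvd D D' hD hD' hNN' hN'4 h16 h4W h4W' hiso]

/-- **C2 is constant on `χ₋₄`-orbits — UNCONDITIONAL**: `2 ∣ c′ ↔ 2 ∣ c` along every `χ₋₄` edge `N ∣ N′ ∣ 4N`, `4² ∣ N′`,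
of lattice-optimal data on globally minimal curves additive at `2`. -/
theorem two_dvd_maninConstant_iff_of_negOne_twist_of_dvd (hD : IsLatticeOptimal D)
    (hD' : IsLatticeOptimal D') (hNN' : N ∣ N') (hN'4 : N' ∣ 4 * N) (h16 : 4 ^ 2 ∣ N')
    (h4W : 2 ^ 2 ∣ W.conductorNorm ℤ) (h4W' : 2 ^ 2 ∣ W'.conductorNorm ℤ)
    (hiso : IsIsogenous (W.quadraticTwist ((-1 : ℤ) : ℚ)) W') : 2 ∣ D'.c ↔ 2 ∣ D.c :=
  two_dvd_maninConstant_iff_of_dvd_of_discrLaw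
    (show NegOneTwistDiscrEqOfAdditive by
      intro W W' _ _ _ _ h4W h4W' hu; obtain ⟨u, hu⟩ := hu
      exact connellPal_Δ_eq_of_negOne_twist_of_four_dvd_conductor_holds W W' u h4W h4W' hu) D D' hD hD' hNN'
    hN'4 h16 h4W h4W' hiso

/-- **LEVEL-RAISING special case (L-es-g34-1 by name, `hΔ`-free)**: `N′ = 4N`, `4 ∣ N`, both conductors `≡ 0 (4)`,
`W ⊗ χ₋₄ ~ W′`, `D, D′` lattice-optimal on globally minimal `W, W′` ⟹ `|c′| = |c|`. -/
theorem maninConstant_natAbs_eq_levelRaising (hD : IsLatticeOptimal D) (hD' : IsLatticeOptimal D')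
    (hN' : N' = 4 * N) (h4 : 4 ∣ N) (h4W : 2 ^ 2 ∣ W.conductorNorm ℤ)
    (h4W' : 2 ^ 2 ∣ W'.conductorNorm ℤ) (hiso : IsIsogenous (W.quadraticTwist ((-1 : ℤ) : ℚ)) W') :
    D'.c.natAbs = D.c.natAbs := by
  have hNN' : N ∣ N' := ⟨4, by rw [hN']; ring⟩
  have hN'4 : N' ∣ 4 * N := by rw [hN']
  have h16 : 4 ^ 2 ∣ N' := by
    obtain ⟨k, hk⟩ := h4
    exact ⟨k, by rw [hN', hk]; ring⟩
  exact maninConstant_natAbs_eq_of_negOne_twist_of_dvd D D' hD hD' hNN' hN'4 h16 h4W h4W' hiso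

/-- The SAME-LEVEL special case `N′ = N`, `2⁴ ∣ N`: `|c′| = |c|` (an's THEOREM I Manin clause, re-derived through the orbit form). -/
theorem maninConstant_natAbs_eq_sameLevel (D₂ : ModularParametrizationData W' N) (hD : IsLatticeOptimal D)
    (hD₂ : IsLatticeOptimal D₂) (h16 : 4 ^ 2 ∣ N) (h4W : 2 ^ 2 ∣ W.conductorNorm ℤ)
    (h4W' : 2 ^ 2 ∣ W'.conductorNorm ℤ) (hiso : IsIsogenous (W.quadraticTwist ((-1 : ℤ) : ℚ)) W') :
    D₂.c.natAbs = D.c.natAbs :=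
  maninConstant_natAbs_eq_of_negOne_twist_of_dvd D D₂ hD hD₂ (dvd_refl N) ⟨4, by ring⟩ h16 h4W
    h4W' hiso

end Edge

/-! ## The u-family rows of §55.5b with the law supplied -/

/-- S-es-g34-2♭ ⟹ S-es-g34-2 (the discriminant clause is the law, now a theorem). -/
theorem uFamilyOptimalNegOneTwinAtSixteen_of_flat' (hT : UFamilyOptimalNegOneTwinAtSixteenFlat) :
    UFamilyOptimalNegOneTwinAtSixteen :=
  uFamilyOptimalNegOneTwinAtSixteen_of_flat hT
    (show NegOneTwistDiscrEqOfAdditive by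
      intro W W' _ _ _ _ h4W h4W' hu; obtain ⟨u, hu⟩ := hu
      exact connellPal_Δ_eq_of_negOne_twist_of_four_dvd_conductor_holds W W' u h4W h4W' hu)

/-- Conversely S-es-g34-2 ⟹ S-es-g34-2♭ (drop the clause), so the two rows are EQUIVALENT in the tree. -/
theorem uFamilyOptimalNegOneTwinAtSixteenFlat_of (hT : UFamilyOptimalNegOneTwinAtSixteen) :
    UFamilyOptimalNegOneTwinAtSixteenFlat := by
  intro W' _ _ _ D' u hD' hU hu h16 h32
  obtain ⟨W, _, _, _, D, hD, hUW, hN, hiso, -⟩ := hT W' D' u hD' hU hu h16 h32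
  exact ⟨W, ‹_›, ‹_›, ‹_›, D, hD, hUW, hN, hiso⟩

/-- S-es-g34-2♭ ⟺ S-es-g34-2. -/
theorem uFamilyOptimalNegOneTwinAtSixteenFlat_iff :
    UFamilyOptimalNegOneTwinAtSixteenFlat ↔ UFamilyOptimalNegOneTwinAtSixteen :=
  ⟨uFamilyOptimalNegOneTwinAtSixteen_of_flat', uFamilyOptimalNegOneTwinAtSixteenFlat_of⟩

/-- C2 on the `16 ∥ N` `u`-family stratum ⟸ C2 on the `4 ∥ N` stratum, modulo S-es-g34-2♭ only (law discharged). -/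
theorem uFamily_maninOdd_sixteen_of_four_of_flat' (hT : UFamilyOptimalNegOneTwinAtSixteenFlat)
    (hodd : ∀ (W : WeierstrassCurve ℚ) [W.IsElliptic] [W.IsGloballyMinimal] [NeZero (W.conductorNorm ℤ)]
      (D : ModularParametrizationData W (W.conductorNorm ℤ)) (u : ℤ),
      IsLatticeOptimal D → IsUFamilyCurve W u → u % 4 = 1 → ¬ 2 ∣ D.c) :
    ∀ (W' : WeierstrassCurve ℚ) [W'.IsElliptic] [W'.IsGloballyMinimal] [NeZero (W'.conductorNorm ℤ)]
      (D' : ModularParametrizationData W' (W'.conductorNorm ℤ)) (u : ℤ),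
      IsLatticeOptimal D' → IsUFamilyCurve W' u → u % 4 = 3 → 2 ^ 4 ∣ W'.conductorNorm ℤ →
      ¬ 2 ^ 5 ∣ W'.conductorNorm ℤ → ¬ 2 ∣ D'.c :=
  uFamily_maninOdd_sixteen_of_four_of_flat hT
    (show NegOneTwistDiscrEqOfAdditive by
      intro W W' _ _ _ _ h4W h4W' hu; obtain ⟨u, hu⟩ := hu
      exact connellPal_Δ_eq_of_negOne_twist_of_four_dvd_conductor_holds W W' u h4W h4W' hu) hodd

end Summit.BirchSwinnertonDyer.Rank1Residual.ManinAdditive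

end
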